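import Summits.FinalStateConjecture.FinalStateConjecture.Theorems.SwallowTheDatumKerrShieldedSettlesStubKerrVacuumAux1
import Summits.FinalStateConjecture.FinalStateConjecture.Theorems.SwallowTheDatumKerrShieldedSettlesStubKerrVacuumAux2
import Summits.FinalStateConjecture.FinalStateConjecture.Theorems.SwallowTheDatumKerrShieldedSettlesStubKerrVacuumAux7
import Literature.Geometry.Lorentzian.ChartMetricCoord
import HarnessLib

/-!
# Kerr is Ricci-flat, XI: the Kerr–Schild quantities at a point are the closed-form tables

Support file for the stub `stub_kerrVacuum` of line `tapered-temporal-collar` (crux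
`stmt-FinalStateConjecture-10054`). At a point `x` of `E4` with Kerr–Schild radius `r > 0` put
`c = Kerr.latitude a x = z/r`; then the defining quartic of `r` reads
`x₂² = (r² + a²)(1 − c²) − x₁²` (`rel_sq`), `Σ = r² + a²c²` (`blSigma_eq`), and the values at `x` of
`H`, `ℓ_μ`, `ℓ^μ`, of the partial derivatives `∂_i r`, `∂_i H`, `∂_i ℓ_μ`, `∂_i∂_j r`, `∂_i∂_j H`,
`∂_i∂_j ℓ_μ` (prelude closed forms and `…StubKerrVacuumAux1`) and of `g_{μν}`, `∂_i g_{μν}`,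
`∂_i∂_j g_{μν}` (product rule, `fderiv_fderiv_bilin`) are the closed-form tables of `…Aux2` at
`(a, M, x¹, x², r, c)`. Kerr–Schild 1965, §§2–3; Visser arXiv:0706.0622, (32)–(36).

## References

* R. P. Kerr, A. Schild (1965), §§2–3; M. Visser, arXiv:0706.0622, (32)–(36).
-/

set_option linter.dupNamespace false
set_option maxSynthPendingDepth 3
set_option linter.unusedSimpArgs false
set_option linter.unusedTactic false
set_option linter.unreachableTactic false
set_option linter.unnecessarySeqFocus false

noncomputable section

open Set Filter
open scoped Topology
open Literature.Geometry.Lorentzian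

namespace Summit.FinalStateConjecture.FinalStateConjecture.Theorems.SwallowTheDatum.KerrShieldedSettles

namespace StubKerrVacuum

variable {a : ℝ} {x : E4}

/-! ### The point data: `r ≠ 0`, `z = r c`, `Σ = r² + a²c²`, the quartic -/

/-- `z = r c`, `c = Kerr.latitude a x = z/r`. [cite: arXiv07060622, (36)] -/
theorem x3_eq (hx : 0 < Kerr.radius a x) : x 3 = Kerr.radius a x * Kerr.latitude a x := by
  rw [Kerr.latitude, mul_div_cancel₀ _ hx.ne']

/-- `Σ = r² + a² c²` (`r²Σ = r⁴ + a²z²`, `z = rc`). [cite: arXiv07060622, (33)–(36)] -/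
theorem blSigma_eq (hx : 0 < Kerr.radius a x) :
    Kerr.blSigma a (E4.spatial x) = Kerr.radius a x ^ 2 + a ^ 2 * Kerr.latitude a x ^ 2 := by
  have h := Kerr.sq_mul_blSigma_spatial a x
  rw [x3_eq hx] at h
  apply mul_left_cancel₀ (pow_ne_zero 2 hx.ne')
  linear_combination h

/-- `r² + a² c² ≠ 0` wherever `r > 0`. [folklore] -/
theorem sig_ne_zero (hx : 0 < Kerr.radius a x) :
    Kerr.radius a x ^ 2 + a ^ 2 * Kerr.latitude a x ^ 2 ≠ 0 := by
  have := hx.ne'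
  positivity

/-- `r² + a² ≠ 0` wherever `r > 0`. [folklore] -/
theorem psq_ne_zero (hx : 0 < Kerr.radius a x) : Kerr.radius a x ^ 2 + a ^ 2 ≠ 0 := by
  have := hx.ne'
  positivity

/-- **The quartic of the Kerr–Schild radius in the variable `c = z/r`**:
`x₂² = (r² + a²)(1 − c²) − x₁²` (divide `r⁴ − (|x⃗|² − a²)r² − a²z² = 0` by `r²`).
[cite: arXiv07060622, (35)] -/
theorem rel_sq (hx : 0 < Kerr.radius a x) :
    x 2 ^ 2 = (Kerr.radius a x ^ 2 + a ^ 2) * (1 - Kerr.latitude a x ^ 2) - x 1 ^ 2 := by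
  have hq := Kerr.radius_quartic a x
  rw [E4.spatialNorm_sq, x3_eq hx] at hq
  apply mul_left_cancel₀ (pow_ne_zero 2 hx.ne')
  linear_combination (-1 : ℝ) * hq

/-! ### `H`, `ℓ`, `ℓ♯`, `g` at the point -/

/-- `H = M r/Σ` is the table value `hT`. [cite: arXiv07060622, (33)] -/
theorem scalarH_eq_hT (M : ℝ) (hx : 0 < Kerr.radius a x) :
    Kerr.scalarH M a x = hT a M (x 1) (x 2) (Kerr.radius a x) (Kerr.latitude a x) := by
  rw [Kerr.scalarH_eq_div_blSigma M a hx, blSigma_eq hx]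
  rfl

/-- `ℓ_μ` is the table value `ellT μ` (`ℓ₃ = z/r = c`). [cite: arXiv07060622, (34)] -/
theorem nullCovectorFun_eq_ellT (M : ℝ) (x : E4) (μ : Fin 4) :
    Kerr.nullCovectorFun a x μ = ellT a M (x 1) (x 2) (Kerr.radius a x) (Kerr.latitude a x) μ := by
  fin_cases μ
  · exact Kerr.nullCovectorFun_apply_zero a x
  · exact Kerr.nullCovectorFun_apply_one a x
  · exact Kerr.nullCovectorFun_apply_two a x
  · exact Kerr.nullCovectorFun_apply_three a x

/-- `ℓ^μ` is the table value `kupT μ`. [cite: KerrSchild1965, §2] -/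
theorem nullVector_eq_kupT (M : ℝ) (x : E4) (μ : Fin 4) :
    Kerr.nullVector a x μ = kupT a M (x 1) (x 2) (Kerr.radius a x) (Kerr.latitude a x) μ := by
  rw [Kerr.nullVector_apply, nullCovectorFun_eq_ellT M x μ]
  fin_cases μ <;> simp [kupT, ellT]

/-- `g(∂_μ, ∂_ν)` is the table value `gT μ ν`. [cite: KerrSchild1965, §2] -/
theorem bilin_eq_gT (M : ℝ) (hx : 0 < Kerr.radius a x) (μ ν : Fin 4) :
    Kerr.bilin M a x (E4.basisVector μ) (E4.basisVector ν) =
      gT a M (x 1) (x 2) (Kerr.radius a x) (Kerr.latitude a x) μ ν := by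
  rw [Kerr.bilin_basisVector, scalarH_eq_hT M hx, nullCovectorFun_eq_ellT M x μ,
    nullCovectorFun_eq_ellT M x ν]
  rfl

/-- `g^{μν}` is the table value `ginvT μ ν`. [cite: KerrSchild1965, §2] -/
theorem inverseMetric_eq_ginvT (M : ℝ) (hx : 0 < Kerr.radius a x) (μ ν : Fin 4) :
    Kerr.inverseMetric M a x μ ν = ginvT a M (x 1) (x 2) (Kerr.radius a x) (Kerr.latitude a x) μ ν := by
  rw [Kerr.inverseMetric_apply, scalarH_eq_hT M hx, nullVector_eq_kupT M x μ,
    nullVector_eq_kupT M x ν, ginvT, etaT]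
  ring

/-! ### First derivatives at the point -/

/-- The components `(∂_μ)^ν` of the coordinate vectors, as a table. [folklore] -/
def bvT : Fin 4 → Fin 4 → ℝ
  | 0, 0 => 1
  | 0, 1 => 0
  | 0, 2 => 0
  | 0, 3 => 0
  | 1, 0 => 0
  | 1, 1 => 1
  | 1, 2 => 0
  | 1, 3 => 0
  | 2, 0 => 0
  | 2, 1 => 0
  | 2, 2 => 1
  | 2, 3 => 0
  | 3, 0 => 0
  | 3, 1 => 0
  | 3, 2 => 0
  | 3, 3 => 1

/-- `(∂_μ)^ν = δ_{μν}`. [folklore] -/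
theorem basisVector_eq_bvT (μ ν : Fin 4) : E4.basisVector μ ν = bvT μ ν := by
  fin_cases μ <;> fin_cases ν <;> simp [E4.basisVector, bvT]

/-- `∂_i r` is the table value `drT i`. [cite: arXiv07060622, (35)] -/
theorem fderiv_radius_eq_drT (M : ℝ) (hx : 0 < Kerr.radius a x) (i : Fin 4) :
    fderiv ℝ (Kerr.radius a) x (E4.basisVector i) = drT a M (x 1) (x 2) (Kerr.radius a x) (Kerr.latitude a x) i := by
  have hr := hx.ne'
  have hS := sig_ne_zero hx
  have hP := psq_ne_zero hx
  rw [Kerr.fderiv_radius_apply hx, blSigma_eq hx, x3_eq hx]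
  fin_cases i <;> simp only [basisVector_eq_bvT, bvT, drT, Fin.isValue] <;> field_simp <;> ring

set_option maxRecDepth 8192 in
set_option maxHeartbeats 4000000 in
/-- `∂_i H` is the table value `dhT i`. [cite: arXiv07060622, (33)] -/
theorem fderiv_scalarH_eq_dhT (M : ℝ) (hx : 0 < Kerr.radius a x) (i : Fin 4) :
    fderiv ℝ (Kerr.scalarH M a) x (E4.basisVector i) = dhT a M (x 1) (x 2) (Kerr.radius a x) (Kerr.latitude a x) i := by
  have hr := hx.ne'
  have hS := sig_ne_zero hx
  have hP := psq_ne_zero hx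
  have hC := rel_sq hx
  rw [Kerr.fderiv_scalarH_apply M hx, fderiv_radius_eq_drT M hx, blSigma_eq hx, x3_eq hx]
  fin_cases i <;> simp only [basisVector_eq_bvT, bvT, drT, dhT, Fin.isValue] <;>
    (field_simp <;> ring_nf <;> (try simp only [xp16 hC, xp15 hC, xp14 hC, xp13 hC, xp12 hC, xp11 hC,
      xp10 hC, xp9 hC, xp8 hC, xp7 hC, xp6 hC, xp5 hC, xp4 hC, xp3 hC, hC]) <;> (try ring_nf))

/-- `∂_i ℓ₀ = 0` (`ℓ₀ = 1`). [cite: arXiv07060622, (34)] -/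
theorem fderiv_nullCovectorFun_zero_eq (M : ℝ) (x : E4) (i : Fin 4) :
    fderiv ℝ (fun z ↦ Kerr.nullCovectorFun a z 0) x (E4.basisVector i) = dlT a M (x 1) (x 2) (Kerr.radius a x) (Kerr.latitude a x) 0 i := by
  have h0 : (fun z ↦ Kerr.nullCovectorFun a z 0) = fun _ ↦ (1 : ℝ) :=
    funext fun z ↦ Kerr.nullCovectorFun_apply_zero a z
  rw [h0]
  simp [dlT]

set_option maxRecDepth 8192 in
set_option maxHeartbeats 4000000 in
/-- `∂_i ℓ₁` is the table value `dlT 1 i`. [cite: arXiv07060622, (34)] -/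
theorem fderiv_nullCovectorFun_one_eq (M : ℝ) (hx : 0 < Kerr.radius a x) (i : Fin 4) :
    fderiv ℝ (fun z ↦ Kerr.nullCovectorFun a z 1) x (E4.basisVector i) = dlT a M (x 1) (x 2) (Kerr.radius a x) (Kerr.latitude a x) 1 i := by
  have hr := hx.ne'
  have hS := sig_ne_zero hx
  have hP := psq_ne_zero hx
  have hC := rel_sq hx
  rw [Kerr.fderiv_nullCovectorFun_one hx, fderiv_radius_eq_drT M hx]
  fin_cases i <;> simp only [basisVector_eq_bvT, bvT, drT, dlT, dl1T, Fin.isValue] <;>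
    (field_simp <;> ring_nf <;> (try simp only [xp16 hC, xp15 hC, xp14 hC, xp13 hC, xp12 hC, xp11 hC,
      xp10 hC, xp9 hC, xp8 hC, xp7 hC, xp6 hC, xp5 hC, xp4 hC, xp3 hC, hC]) <;> (try ring_nf))

set_option maxRecDepth 8192 in
set_option maxHeartbeats 4000000 in
/-- `∂_i ℓ₂` is the table value `dlT 2 i`. [cite: arXiv07060622, (34)] -/
theorem fderiv_nullCovectorFun_two_eq (M : ℝ) (hx : 0 < Kerr.radius a x) (i : Fin 4) :
    fderiv ℝ (fun z ↦ Kerr.nullCovectorFun a z 2) x (E4.basisVector i) = dlT a M (x 1) (x 2) (Kerr.radius a x) (Kerr.latitude a x) 2 i := by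
  have hr := hx.ne'
  have hS := sig_ne_zero hx
  have hP := psq_ne_zero hx
  have hC := rel_sq hx
  rw [Kerr.fderiv_nullCovectorFun_two hx, fderiv_radius_eq_drT M hx]
  fin_cases i <;> simp only [basisVector_eq_bvT, bvT, drT, dlT, dl2T, Fin.isValue] <;>
    (field_simp <;> ring_nf <;> (try simp only [xp16 hC, xp15 hC, xp14 hC, xp13 hC, xp12 hC, xp11 hC,
      xp10 hC, xp9 hC, xp8 hC, xp7 hC, xp6 hC, xp5 hC, xp4 hC, xp3 hC, hC]) <;> (try ring_nf))

set_option maxRecDepth 8192 in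
set_option maxHeartbeats 4000000 in
/-- `∂_i ℓ₃` is the table value `dlT 3 i`. [cite: arXiv07060622, (34)] -/
theorem fderiv_nullCovectorFun_three_eq (M : ℝ) (hx : 0 < Kerr.radius a x) (i : Fin 4) :
    fderiv ℝ (fun z ↦ Kerr.nullCovectorFun a z 3) x (E4.basisVector i) = dlT a M (x 1) (x 2) (Kerr.radius a x) (Kerr.latitude a x) 3 i := by
  have hr := hx.ne'
  have hS := sig_ne_zero hx
  have hP := psq_ne_zero hx
  have hC := rel_sq hx
  rw [Kerr.fderiv_nullCovectorFun_three hx, fderiv_radius_eq_drT M hx, x3_eq hx]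
  fin_cases i <;> simp only [basisVector_eq_bvT, bvT, drT, dlT, dl3T, Fin.isValue] <;>
    (field_simp <;> ring_nf <;> (try simp only [xp16 hC, xp15 hC, xp14 hC, xp13 hC, xp12 hC, xp11 hC,
      xp10 hC, xp9 hC, xp8 hC, xp7 hC, xp6 hC, xp5 hC, xp4 hC, xp3 hC, hC]) <;> (try ring_nf))

/-- `∂_i ℓ_μ` is the table value `dlT μ i`. [cite: arXiv07060622, (34)] -/
theorem fderiv_nullCovectorFun_eq_dlT (M : ℝ) (hx : 0 < Kerr.radius a x) (μ i : Fin 4) :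
    fderiv ℝ (fun z ↦ Kerr.nullCovectorFun a z μ) x (E4.basisVector i) = dlT a M (x 1) (x 2) (Kerr.radius a x) (Kerr.latitude a x) μ i := by
  fin_cases μ
  exacts [fderiv_nullCovectorFun_zero_eq M x i, fderiv_nullCovectorFun_one_eq M hx i,
    fderiv_nullCovectorFun_two_eq M hx i, fderiv_nullCovectorFun_three_eq M hx i]

/-- `∂_i g(∂_μ, ∂_ν)` is the product-rule value `dgT i μ ν`. [cite: KerrSchild1965, §2] -/
theorem fderiv_bilin_eq_dgT (M : ℝ) (hx : 0 < Kerr.radius a x) (i μ ν : Fin 4) :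
    fderiv ℝ (Kerr.bilin M a) x (E4.basisVector i) (E4.basisVector μ) (E4.basisVector ν) =
      dgT a M (x 1) (x 2) (Kerr.radius a x) (Kerr.latitude a x) i μ ν := by
  rw [Kerr.fderiv_bilin_basisVector M a hx, fderiv_scalarH_eq_dhT M hx,
    fderiv_nullCovectorFun_eq_dlT M hx, fderiv_nullCovectorFun_eq_dlT M hx, scalarH_eq_hT M hx,
    nullCovectorFun_eq_ellT M x μ, nullCovectorFun_eq_ellT M x ν]
  rfl

end StubKerrVacuum

/-- **Registered sub-goal `stub_kerrVacuumDMetric`** of stub `stub_kerrVacuum` (line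
`tapered-temporal-collar`): the first partial derivatives of the Kerr–Schild components at a point
with `r > 0` are the closed-form table `dgT` at `(a, M, x¹, x², r, z/r)`.
[cite: KerrSchild1965, §2] -/
theorem stub_kerrVacuumDMetric : ∀ (a M : ℝ) (x : E4), 0 < Kerr.radius a x → ∀ (i μ ν : Fin 4),
    fderiv ℝ (Kerr.bilin M a) x (E4.basisVector i) (E4.basisVector μ) (E4.basisVector ν)
    = StubKerrVacuum.dgT a M (x 1) (x 2) (Kerr.radius a x) (Kerr.latitude a x) i μ ν :=
  fun _ M _ hx i μ ν ↦ StubKerrVacuum.fderiv_bilin_eq_dgT M hx i μ ν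

end Summit.FinalStateConjecture.FinalStateConjecture.Theorems.SwallowTheDatum.KerrShieldedSettles

end
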